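import Summits.BirchSwinnertonDyer.BirchSwinnertonDyer.Theorems.TameQuarticManinParityIrrOrganOfPub
import Summits.BirchSwinnertonDyer.BirchSwinnertonDyer.Theorems.TameQuarticManinParityTwistLatticeDichotomyOfOptimalTwist
import Summits.BirchSwinnertonDyer.BirchSwinnertonDyer.Theorems.TameQuarticManinParityTwistPartnerOptimalDatumOfModularity
import HarnessLib

/-!
# Route `TameQuarticManinParity`, LINES 22–26 (bsd-idea-3 g8): the Dokchitser–Dokchitser binder DISCHARGED —
# X22, D24, the organ 24498 and the crux 23736 relative to MODULARITY (and ČNS) only (`--supports` 24498)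

Cell `pub/bsd-wall`, D-0145 line `route-BirchSwinnertonDyer-TeichmullerTwistDescent`, seat `bsd-line-ttd-p1` g11
(bookkeeping for the planner-of-record's TQMP LINES 22–26). BSD is NOT proved by this; Manin's conjecture at 3 is
not proved; D24 (22544), the organ `TprimeIrrManinUnitOfThreeDvdDegree` (24498) and the crux
`TprimeIrreducibleManinUnit` (23736) stay OPEN — every statement below keeps modularity (`exists_isNewformOf`,
cite-only) and, where the Manin unit is concerned, Česnavičius–Neururer–Saha Thm 1.2 (cite-only) and ONE Kodaira half
of the organ as explicit hypotheses.

What changes relative to the landed `…OfPub` / `…OfFacts` theorems (seat g10): their hypothesis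
`dokchitser_padicValInt_minimalDiscriminantInt_eq_of_isogeny_of_not_dvd_degree` (Dokchitser–Dokchitser 2015
Thm. 5.1 (1)) is a THEOREM of the tree (`…_holds`, `IsogenyPotentiallyGoodMinimalDiscriminantProofs`, seat ttd-p2 g5),
consumed once in `tprimeIrrTwistPartnerOptimalDatum_of_modularity` (X22m closer file); everything downstream loses
that binder:

* D24 `TprimeIrrTwistLatticeDichotomy` ⟸ modularity alone;
* organ 24498 and crux 23736 ⟸ {modularity, ČNS} + [3 ∤ c on the Kodaira-III rows], or
  ⟸ {modularity, ČNS} + O22 + [3 ∤ c on the Kodaira-III* rows].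

Design: compositions by name; no definition, no new named fact, no `sorry`; axioms `propext`, `Classical.choice`,
`Quot.sound`.
-/

set_option autoImplicit false
-- D-0017: single-problem summit, so `Summit.BirchSwinnertonDyer.BirchSwinnertonDyer.…` repeats a namespace BY DESIGN.
set_option linter.dupNamespace false

noncomputable section

namespace Summit.BirchSwinnertonDyer.BirchSwinnertonDyer.Theorems.TameQuarticManinParity

open Literature.NumberTheory.EllipticCurves Literature.NumberTheory.EllipticCurves.ModularForms
  Summit.BirchSwinnertonDyer.BirchSwinnertonDyer.Theses.TameQuarticManinParity

/-- **D24 `TprimeIrrTwistLatticeDichotomy` (stmt-22544) GRANTED MODULARITY ONLY**: T24L, M25 are theorems of the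
tree, X22 follows from `exists_isNewformOf` (`tprimeIrrTwistPartnerOptimalDatum_of_modularity`).
[cite: BCDTJAMS2001, Thm. A] -/
theorem tprimeIrrTwistLatticeDichotomy_of_modularity (hnf : exists_isNewformOf) :
    TprimeIrrTwistLatticeDichotomy :=
  tprimeIrrTwistLatticeDichotomyOfOptimalTwist_proof (tprimeIrrTwistPartnerOptimalDatum_of_modularity hnf)
    tprimeIrrOptimalTwistNeronLattice_proof tprimeIrrTwistPairManinDivisibility_proof

/-! ## §1 From the Kodaira-III rows -/

/-- **Organ 24498 from its Kodaira-III rows, granted {modularity, ČNS}.** If `3 ∤ c(D)` holds for every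
X₀(N)-optimal datum `D` with `3 ∣ deg D` on the irreducible non-CM (t′) rows with `ord₃ Δ_min = 3`, then it holds on
all irreducible non-CM (t′) rows. [cite: BCDTJAMS2001, Thm. A] [cite: CesnaviciusNeururerSaha2023, Thm. 1.2] -/
theorem tprimeIrrManinUnitOfThreeDvdDegree_of_modularity_of_cns_of_III (hnf : exists_isNewformOf)
    (hCNS : cesnaviciusNeururerSaha_padicVal_maninConstant_le_modularDegree)
    (hIII : ∀ (W : WeierstrassCurve ℚ) [W.IsElliptic] [W.IsGloballyMinimal] [NeZero (W.conductorNorm ℤ)],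
      ¬ W.HasCM → Rank1Residual.Addv W 3 → Summit.BirchSwinnertonDyer.Rank1Residual.Additive.SubTprime W 3 →
      W.HasIrreducibleModPGaloisRep 3 → padicValInt 3 W.minimalDiscriminantInt = 3 →
      ∀ (D : ModularParametrizationData W (W.conductorNorm ℤ)),
        (∀ z ∈ D.L.lattice, ∃ w ∈ periodLattice D.f, z = D.c * w) →
        (∀ (W' : WeierstrassCurve ℚ) [W'.IsElliptic] (D' : ModularParametrizationData W' (W.conductorNorm ℤ)),
          D'.f = D.f → D.modularDegree ≤ D'.modularDegree) →
        3 ∣ D.modularDegree → ¬ (3 : ℤ) ∣ D.maninConstant) :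
    TprimeIrrManinUnitOfThreeDvdDegree :=
  tprimeIrrManinUnitOfThreeDvdDegree_of_pub_of_III hnf
    dokchitser_padicValInt_minimalDiscriminantInt_eq_of_isogeny_of_not_dvd_degree_holds hCNS hIII

/-- **The crux `TprimeIrreducibleManinUnit` (23736) from the Kodaira-III rows of the organ, granted {modularity,
ČNS}.** [cite: BCDTJAMS2001, Thm. A] [cite: CesnaviciusNeururerSaha2023, Thm. 1.2] -/
theorem tprimeIrreducibleManinUnit_of_modularity_of_cns_of_III (hnf : exists_isNewformOf)
    (hCNS : cesnaviciusNeururerSaha_padicVal_maninConstant_le_modularDegree)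
    (hIII : ∀ (W : WeierstrassCurve ℚ) [W.IsElliptic] [W.IsGloballyMinimal] [NeZero (W.conductorNorm ℤ)],
      ¬ W.HasCM → Rank1Residual.Addv W 3 → Summit.BirchSwinnertonDyer.Rank1Residual.Additive.SubTprime W 3 →
      W.HasIrreducibleModPGaloisRep 3 → padicValInt 3 W.minimalDiscriminantInt = 3 →
      ∀ (D : ModularParametrizationData W (W.conductorNorm ℤ)),
        (∀ z ∈ D.L.lattice, ∃ w ∈ periodLattice D.f, z = D.c * w) →
        (∀ (W' : WeierstrassCurve ℚ) [W'.IsElliptic] (D' : ModularParametrizationData W' (W.conductorNorm ℤ)),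
          D'.f = D.f → D.modularDegree ≤ D'.modularDegree) →
        3 ∣ D.modularDegree → ¬ (3 : ℤ) ∣ D.maninConstant) :
    TprimeIrreducibleManinUnit :=
  tprimeIrreducibleManinUnit_of_pub_of_III hnf
    dokchitser_padicValInt_minimalDiscriminantInt_eq_of_isogeny_of_not_dvd_degree_holds hCNS hIII

/-! ## §2 From the orientation and the Kodaira-III* rows -/

/-- **Organ 24498 from the orientation O22 and its Kodaira-III* rows, granted {modularity, ČNS}.**
[cite: BCDTJAMS2001, Thm. A] [cite: CesnaviciusNeururerSaha2023, Thm. 1.2] -/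
theorem tprimeIrrManinUnitOfThreeDvdDegree_of_modularity_of_cns_of_orientation_of_IIIstar (hnf : exists_isNewformOf)
    (hCNS : cesnaviciusNeururerSaha_padicVal_maninConstant_le_modularDegree)
    (hO : TprimeIrrTwistLatticeOrientation)
    (hIIIstar : ∀ (W : WeierstrassCurve ℚ) [W.IsElliptic] [W.IsGloballyMinimal] [NeZero (W.conductorNorm ℤ)],
      ¬ W.HasCM → Rank1Residual.Addv W 3 → Summit.BirchSwinnertonDyer.Rank1Residual.Additive.SubTprime W 3 →
      W.HasIrreducibleModPGaloisRep 3 → padicValInt 3 W.minimalDiscriminantInt = 9 →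
      ∀ (D : ModularParametrizationData W (W.conductorNorm ℤ)),
        (∀ z ∈ D.L.lattice, ∃ w ∈ periodLattice D.f, z = D.c * w) →
        (∀ (W' : WeierstrassCurve ℚ) [W'.IsElliptic] (D' : ModularParametrizationData W' (W.conductorNorm ℤ)),
          D'.f = D.f → D.modularDegree ≤ D'.modularDegree) →
        3 ∣ D.modularDegree → ¬ (3 : ℤ) ∣ D.maninConstant) :
    TprimeIrrManinUnitOfThreeDvdDegree :=
  tprimeIrrManinUnitOfThreeDvdDegree_of_pub_of_orientation_of_IIIstar hnf
    dokchitser_padicValInt_minimalDiscriminantInt_eq_of_isogeny_of_not_dvd_degree_holds hCNS hO hIIIstar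

/-- **The crux `TprimeIrreducibleManinUnit` (23736) from O22 and the Kodaira-III* rows of the organ, granted
{modularity, ČNS}.** [cite: BCDTJAMS2001, Thm. A] [cite: CesnaviciusNeururerSaha2023, Thm. 1.2] -/
theorem tprimeIrreducibleManinUnit_of_modularity_of_cns_of_orientation_of_IIIstar (hnf : exists_isNewformOf)
    (hCNS : cesnaviciusNeururerSaha_padicVal_maninConstant_le_modularDegree)
    (hO : TprimeIrrTwistLatticeOrientation)
    (hIIIstar : ∀ (W : WeierstrassCurve ℚ) [W.IsElliptic] [W.IsGloballyMinimal] [NeZero (W.conductorNorm ℤ)],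
      ¬ W.HasCM → Rank1Residual.Addv W 3 → Summit.BirchSwinnertonDyer.Rank1Residual.Additive.SubTprime W 3 →
      W.HasIrreducibleModPGaloisRep 3 → padicValInt 3 W.minimalDiscriminantInt = 9 →
      ∀ (D : ModularParametrizationData W (W.conductorNorm ℤ)),
        (∀ z ∈ D.L.lattice, ∃ w ∈ periodLattice D.f, z = D.c * w) →
        (∀ (W' : WeierstrassCurve ℚ) [W'.IsElliptic] (D' : ModularParametrizationData W' (W.conductorNorm ℤ)),
          D'.f = D.f → D.modularDegree ≤ D'.modularDegree) →
        3 ∣ D.modularDegree → ¬ (3 : ℤ) ∣ D.maninConstant) :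
    TprimeIrreducibleManinUnit :=
  tprimeIrreducibleManinUnit_of_pub_of_orientation_of_IIIstar hnf
    dokchitser_padicValInt_minimalDiscriminantInt_eq_of_isogeny_of_not_dvd_degree_holds hCNS hO hIIIstar

end Summit.BirchSwinnertonDyer.BirchSwinnertonDyer.Theorems.TameQuarticManinParity

end
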